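import Summits.AtomisticToContinuum.Crystallization.Theorems.ExcessDecayLiouvilleSiteGeometry

/-!
# `ExcessDecayLiouville.HcpLiouville` (stmt-AtomisticToContinuum-9332), line `Sketch`: the site dichotomy

Registered helper `dist_sites_le_or_ge` of the line `two-level-caccioppoli` (crux `HcpLiouville`, lead
skeleton `Lines/Sketch.lean`), used by stub `stub_secant_of_box` (box ⇒ ray-secant coercivity) and by
every step that moves the datum inside the admissible window: for an admissible cell `A` (`Adm₀ A`) and
hcp-like translations `t` (`Inner₀ t A`), two sites of `Sites₀ t A` are either at distance `≤ 51/50` (a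
nearest-neighbour bond) or at distance `≥ 131/100`.  In particular moving sublattice `1` by a vector of
norm `≤ 1/20` inside the window does not change the nearest-neighbour graph `dist ≤ 11/10`.

Proof.  Same sublattice: the distance is `‖A ζ‖`, `ζ ∈ Λ₀`, and `‖ζ‖² = i² + ij + j² + (8/3)k²`
(`hcpLiouvilleLam_norm_sq`) lies in `{0, 1} ∪ [8/3, ∞)` because the Löschian form `i² + ij + j²` omits
the value `2`; so `‖A ζ‖ ≤ 199/200` (`norm_apply_le_of_adm₀`) or `‖A ζ‖ ≥ (189/200)√(8/3) > 131/100`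
(`hcpLiouvilleAdm_norm_le`).  Cross sublattice: the distance is `‖A (w + √(2/3)e₃ + ζ) + d‖` with
`‖d‖ ≤ 1/40` and `‖w + √(2/3)e₃ + ζ‖² = (3(2i+j+1)² + (1+3j)²)/12 + (2/3)(1+2k)²` with
`3(2i+j+1)² + (1+3j)² ∈ {4} ∪ [16, ∞)` and `(1+2k)² ∈ {1} ∪ [9, ∞)`, so the motif norm is `1` (distance
`≤ 199/200 + 1/40 = 51/50`) or its square is `≥ 2` (distance `≥ (189/200)√2 − 1/40 > 131/100`).
All `[folklore]`; a `--supports` helper for item stmt-AtomisticToContinuum-9332, nothing here closes an item.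
-/

noncomputable section

namespace Summit.AtomisticToContinuum.Crystallization.Theorems.ExcessDecayLiouville

open scoped BigOperators Topology Classical InnerProductSpace
open Literature.MathematicalPhysics.StatisticalMechanics
open Summit.AtomisticToContinuum.Crystallization.Theses.ExcessDecayLiouville
open Summit.AtomisticToContinuum.Crystallization.Theorems.PhononStabilityNegative

local notation "E3" => EuclideanSpace ℝ (Fin 3)

/-! ## Integer forms -/

/-- The Löschian form `i² + ij + j²` takes the values `0`, `1` or `≥ 3` on `ℤ²` (never `2`). [folklore] -/
private theorem loeschian_cases (i j : ℤ) :
    i ^ 2 + i * j + j ^ 2 = 0 ∨ i ^ 2 + i * j + j ^ 2 = 1 ∨ 3 ≤ i ^ 2 + i * j + j ^ 2 := by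
  by_contra h
  push Not at h
  obtain ⟨h0, h1, h3⟩ := h
  have hlo : 0 ≤ i ^ 2 + i * j + j ^ 2 := by nlinarith [sq_nonneg (2 * i + j), sq_nonneg j]
  have h2 : i ^ 2 + i * j + j ^ 2 = 2 := by omega
  have hj : j ^ 2 ≤ 2 := by nlinarith [sq_nonneg (2 * i + j)]
  have hi : i ^ 2 ≤ 2 := by nlinarith [sq_nonneg (i + 2 * j)]
  have hj1 : j ≤ 1 := by nlinarith
  have hj2 : -1 ≤ j := by nlinarith
  have hi1 : i ≤ 1 := by nlinarith
  have hi2 : -1 ≤ i := by nlinarith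
  interval_cases i <;> interval_cases j <;> omega

/-- The cross-sublattice form `3(2i+j+1)² + (1+3j)²` is `4` or `≥ 16` on `ℤ²`. [folklore] -/
private theorem motif_form_cases (i j : ℤ) :
    3 * (2 * i + j + 1) ^ 2 + (1 + 3 * j) ^ 2 = 4 ∨ 16 ≤ 3 * (2 * i + j + 1) ^ 2 + (1 + 3 * j) ^ 2 := by
  rcases lt_trichotomy j 0 with hj | rfl | hj
  · rcases eq_or_lt_of_le (Int.le_sub_one_iff.2 hj) with rfl | hj'
    · rcases eq_or_ne i 0 with rfl | hi
      · left; norm_num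
      · right; nlinarith [Int.one_le_abs hi, sq_abs i]
    · right
      have h5 : 1 + 3 * j ≤ -5 := by omega
      nlinarith [sq_nonneg (2 * i + j + 1)]
  · rcases em (i = 0 ∨ i = -1) with hi | hi
    · left; rcases hi with rfl | rfl <;> norm_num
    · right
      push Not at hi
      have h3 : 3 ≤ |2 * i + 1| := by
        rcases lt_or_gt_of_ne hi.1 with h | h
        · rw [abs_of_neg (by omega)]; omega
        · rw [abs_of_pos (by omega)]; omega
      nlinarith [sq_abs (2 * i + 1)]
  · right
    have h4 : 4 ≤ 1 + 3 * j := by omega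
    nlinarith [sq_nonneg (2 * i + j + 1)]

/-- `(1 + 2k)²` is `1` or `≥ 9` on `ℤ`. [folklore] -/
private theorem odd_sq_cases (k : ℤ) : (1 + 2 * k) ^ 2 = 1 ∨ 9 ≤ (1 + 2 * k) ^ 2 := by
  rcases em (k = 0 ∨ k = -1) with hk | hk
  · left; rcases hk with rfl | rfl <;> norm_num
  · right
    push Not at hk
    have h3 : 3 ≤ |1 + 2 * k| := by
      rcases lt_or_gt_of_ne hk.1 with h | h
      · rw [abs_of_neg (by omega)]; omega
      · rw [abs_of_pos (by omega)]; omega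
    nlinarith [sq_abs (1 + 2 * k)]

/-! ## Norms of lattice and motif vectors -/

/-- Squared norms of vectors of `Λ₀` are `0`, `1` or `≥ 8/3`. [folklore] -/
private theorem norm_sq_Λ₀_cases {ζ : E3} (hζ : ζ ∈ Λ₀) :
    ‖ζ‖ ^ 2 = 0 ∨ ‖ζ‖ ^ 2 = 1 ∨ 8 / 3 ≤ ‖ζ‖ ^ 2 := by
  obtain ⟨i, j, k, rfl⟩ := hζ
  rw [hcpLiouvilleLam_norm_sq i j k]
  have hnn : (0 : ℝ) ≤ (i : ℝ) ^ 2 + i * j + j ^ 2 := by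
    nlinarith [sq_nonneg (2 * (i : ℝ) + j), sq_nonneg (j : ℝ)]
  rcases eq_or_ne k 0 with rfl | hk
  · rcases loeschian_cases i j with h | h | h
    · left
      have h' : (i : ℝ) ^ 2 + i * j + j ^ 2 = 0 := by exact_mod_cast h
      rw [h']; simp
    · right; left
      have h' : (i : ℝ) ^ 2 + i * j + j ^ 2 = 1 := by exact_mod_cast h
      rw [h']; simp
    · right; right
      have h' : (3 : ℝ) ≤ (i : ℝ) ^ 2 + i * j + j ^ 2 := by exact_mod_cast h
      simp; linarith
  · right; right
    have hk1 : (1 : ℝ) ≤ (k : ℝ) ^ 2 := by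
      have : 1 ≤ k ^ 2 := by nlinarith [Int.one_le_abs hk, sq_abs k]
      exact_mod_cast this
    linarith

/-- The squared norm of the motif vector `w + √(2/3)e₃ + l`, `l ∈ Λ₀`, is `1` or `≥ 2`. [folklore] -/
private theorem norm_sq_motif_cases {l : E3} (hl : l ∈ Λ₀) :
    ‖barlowOffset 1 + layerNormal (Real.sqrt (2 / 3)) + l‖ ^ 2 = 1 ∨
      2 ≤ ‖barlowOffset 1 + layerNormal (Real.sqrt (2 / 3)) + l‖ ^ 2 := by
  obtain ⟨i, j, k, rfl⟩ := hl
  obtain ⟨hz0, hz1, hz2⟩ := hcpLiouvilleLam_apply i j k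
  set z : E3 := (i : ℝ) • triangularVec₁ 1 + (j : ℝ) • triangularVec₂ 1 +
    (k : ℝ) • layerNormal (2 * Real.sqrt (2 / 3)) with hzdef
  set v : E3 := barlowOffset 1 + layerNormal (Real.sqrt (2 / 3)) + z with hv
  have hv0 : v 0 = 1 / 2 + (i + j * 2⁻¹) := by
    rw [hv, PiLp.add_apply, PiLp.add_apply, hz0]; simp [barlowOffset, layerNormal]
  have hv1 : v 1 = √3 / 6 + j * (√3 / 2) := by
    rw [hv, PiLp.add_apply, PiLp.add_apply, hz1]; simp [barlowOffset, layerNormal]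
  have hv2 : v 2 = Real.sqrt (2 / 3) + k * (2 * Real.sqrt (2 / 3)) := by
    rw [hv, PiLp.add_apply, PiLp.add_apply, hz2]; simp [barlowOffset, layerNormal]
  have s3 : (√3 : ℝ) ^ 2 = 3 := Real.sq_sqrt (by norm_num)
  have s23 : (Real.sqrt (2 / 3)) ^ 2 = 2 / 3 := Real.sq_sqrt (by norm_num)
  have hnorm : ‖v‖ ^ 2 =
      (3 * (2 * (i : ℝ) + j + 1) ^ 2 + (1 + 3 * (j : ℝ)) ^ 2) / 12 + 2 / 3 * (1 + 2 * (k : ℝ)) ^ 2 := by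
    rw [EuclideanSpace.norm_sq_eq, Fin.sum_univ_three]
    simp only [Real.norm_eq_abs, sq_abs]
    rw [hv0, hv1, hv2]
    linear_combination (1 / 6 + (j : ℝ) / 2) ^ 2 * s3 + (1 + 2 * (k : ℝ)) ^ 2 * s23
  rw [hnorm]
  rcases motif_form_cases i j with hF | hF <;> rcases odd_sq_cases k with hG | hG
  · left
    have hF' : 3 * (2 * (i : ℝ) + j + 1) ^ 2 + (1 + 3 * (j : ℝ)) ^ 2 = 4 := by exact_mod_cast hF
    have hG' : (1 + 2 * (k : ℝ)) ^ 2 = 1 := by exact_mod_cast hG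
    rw [hF', hG']; norm_num
  · right
    have hF' : 3 * (2 * (i : ℝ) + j + 1) ^ 2 + (1 + 3 * (j : ℝ)) ^ 2 = 4 := by exact_mod_cast hF
    have hG' : (9 : ℝ) ≤ (1 + 2 * (k : ℝ)) ^ 2 := by exact_mod_cast hG
    rw [hF']; linarith
  · right
    have hF' : (16 : ℝ) ≤ 3 * (2 * (i : ℝ) + j + 1) ^ 2 + (1 + 3 * (j : ℝ)) ^ 2 := by exact_mod_cast hF
    have hG' : (1 + 2 * (k : ℝ)) ^ 2 = 1 := by exact_mod_cast hG
    rw [hG']; linarith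
  · right
    have hF' : (16 : ℝ) ≤ 3 * (2 * (i : ℝ) + j + 1) ^ 2 + (1 + 3 * (j : ℝ)) ^ 2 := by exact_mod_cast hF
    have hG' : (9 : ℝ) ≤ (1 + 2 * (k : ℝ)) ^ 2 := by exact_mod_cast hG
    linarith

/-! ## The dichotomy -/

/-- Same sublattice: two sites `x + A z`, `x + A z'` (`z, z' ∈ Λ₀`) of an admissible cell are at distance
`≤ 51/50` or `≥ 131/100`. [folklore] -/
private theorem dist_same_cases {A : E3 →L[ℝ] E3} (hA : Adm₀ A) (x : E3) {z z' : E3} (hz : z ∈ Λ₀)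
    (hz' : z' ∈ Λ₀) :
    dist (x + A z) (x + A z') ≤ 51 / 50 ∨ 131 / 100 ≤ dist (x + A z) (x + A z') := by
  have hd : dist (x + A z) (x + A z') = ‖A (z - z')‖ := by
    rw [dist_eq_norm, add_sub_add_left_eq_sub, map_sub]
  rw [hd]
  have hmem : z - z' ∈ Λ₀ := hcpLiouvilleLam_sub_mem hz hz'
  rcases norm_sq_Λ₀_cases hmem with h | h | h
  · left
    have h0 : z - z' = 0 := by
      rwa [sq_eq_zero_iff, norm_eq_zero] at h
    rw [h0, map_zero, norm_zero]; norm_num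
  · left
    have h1 : ‖z - z'‖ = 1 := (pow_eq_one_iff_of_nonneg (norm_nonneg _) two_ne_zero).1 h
    have h2 := norm_apply_le_of_adm₀ hA (z - z')
    rw [h1] at h2; linarith
  · right
    have h1 := hcpLiouvilleAdm_norm_le hA (z - z')
    have h2 : 131 / 100 ≤ 189 / 200 * ‖z - z'‖ := by nlinarith [norm_nonneg (z - z')]
    linarith

/-- Cross sublattice: a site of sublattice `1` and a site of sublattice `0` of an admissible hcp-like datum
are at distance `≤ 51/50` or `≥ 131/100`. [folklore] -/
private theorem dist_cross_cases {A : E3 →L[ℝ] E3} {t : Fin 2 → E3} (hA : Adm₀ A) (hI : Inner₀ t A)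
    {z z' : E3} (hz : z ∈ Λ₀) (hz' : z' ∈ Λ₀) :
    dist (t 1 + A z') (t 0 + A z) ≤ 51 / 50 ∨ 131 / 100 ≤ dist (t 1 + A z') (t 0 + A z) := by
  set d : E3 := t 1 - t 0 - A (barlowOffset 1 + layerNormal (Real.sqrt (2 / 3))) with hd
  have hdn : ‖d‖ ≤ 1 / 40 := hI
  have hmem : z' - z ∈ Λ₀ := hcpLiouvilleLam_sub_mem hz' hz
  set y : E3 := barlowOffset 1 + layerNormal (Real.sqrt (2 / 3)) + (z' - z) with hy
  have hsplit : t 1 + A z' - (t 0 + A z) = A y + d := by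
    rw [hy, hd, map_add, map_sub]; abel
  rw [dist_eq_norm, hsplit]
  rcases norm_sq_motif_cases hmem with h | h
  · left
    have h1 : ‖y‖ = 1 := (pow_eq_one_iff_of_nonneg (norm_nonneg _) two_ne_zero).1 h
    have h2 := norm_apply_le_of_adm₀ hA y
    have h3 := norm_add_le (A y) d
    rw [h1] at h2; linarith
  · right
    have h1 := hcpLiouvilleAdm_norm_le hA y
    have h3 := norm_sub_norm_le (A y) (-d)
    rw [sub_neg_eq_add, norm_neg] at h3
    have h2 : 267 / 200 ≤ 189 / 200 * ‖y‖ := by nlinarith [norm_nonneg y]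
    linarith

/-- **Site dichotomy** (registered helper of crux stmt-AtomisticToContinuum-9332, line `Sketch`): two
sites of an admissible hcp-like datum are at distance `≤ 51/50` or `≥ 131/100`; there is no site pair at
intermediate distance, so the nearest-neighbour graph `dist ≤ 11/10` is stable under perturbations of the
datum of size `< 29/100` inside the window. [folklore] -/
theorem dist_sites_le_or_ge : ∀ (t : Fin 2 → E3) (A : E3 →L[ℝ] E3), Adm₀ A → Inner₀ t A → ∀ p ∈ Sites₀ t A, ∀ q ∈ Sites₀ t A, dist p q ≤ 51 / 50 ∨ 131 / 100 ≤ dist p q := by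
  intro t A hA hI p hp q hq
  obtain ⟨m, z, hz, rfl⟩ := hp
  obtain ⟨m', z', hz', rfl⟩ := hq
  fin_cases m <;> fin_cases m'
  · simp only [Fin.zero_eta]
    exact dist_same_cases hA (t 0) hz hz'
  · simp only [Fin.zero_eta, Fin.mk_one]
    rw [dist_comm]; exact dist_cross_cases hA hI hz hz'
  · simp only [Fin.zero_eta, Fin.mk_one]
    exact dist_cross_cases hA hI hz' hz
  · simp only [Fin.mk_one]
    exact dist_same_cases hA (t 1) hz hz'

end Summit.AtomisticToContinuum.Crystallization.Theorems.ExcessDecayLiouville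

end
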